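import Mathlib.GroupTheory.SpecificGroups.Dihedral
import Literature.Combinatorics.Additive.TripleProductProperty

/-!
# ω-census, family (b3): the dihedral TPP family `⟨2, 2, 2n/3⟩` in `D_{2n}` (3 ∣ n) — kernel witnesses

HONEST FRAMING (pub-omega census; verbatim): lottery ticket; floor = certified bounds/negative ranges.
Positive side of the census law for dihedral groups.  The SAT census (kit j081680-family jobs j083548, j085782, j086172) found, for every
`4 ≤ n ≤ 16` tested, that the TPP volume (Hedtke–Murthy's `β`) of the dihedral group of order `2n` is EXACTLY `4·⌊2n/3⌋` — i.e. about
`(4/3)|G|`, far below the sum of the cubes `Σ dᵢ³ = 2|G| − 2` or `2|G| − 4` — with the maximum attained by a triple of sizes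
`(2, 2, ⌊2n/3⌋)`.  For `3 ∣ n` the witnesses have the uniform shape `S = {1, s}`, `T = {1, s r}`, `U = K ∪ s r² K`, `K = ⟨r³⟩`
(so `Q(S) = {1, s}`, `Q(T) = {1, sr}`, `Q(U) = K ∪ s r² K`, and `s, sr, r⁻¹ ∉ Q(U)` because `3 ∤ 1, 2`), which is a TPP triple for
EVERY `n = 3m` (volume `8m = (4/3)|D_{6m}|`); this file certifies the instances `m = 3, …, 8` (`D₁₈ … D₄₈`) by `decide` (`m = 2` is the tree's `dihedral12_realizes_224`) — the general
statement is recorded as the census conjecture "β(D_{2n}) = 4⌊2n/3⌋ for all n ≥ 4" (lower bound: this family and its analogues for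
`3 ∤ n`; upper bound: SAT/DRAT for n ≤ 24, kit j086172; no proof of the upper bound is claimed).
-/

namespace Summit.MatrixMultiplication.OmegaCensus

open Literature.Combinatorics.Additive

-- m = 2 (`D₁₂`, ⟨2,2,4⟩) is the tree's `dihedral12_realizes_224` (Dihedral12TPPVolume.lean) — the same triple.

/-- `D_{18} = DihedralGroup 9` realizes `⟨2, 2, 6⟩` (volume `24` = (4/3)·|G|): `S = {1, s}`, `T = {1, sr}`,
`U = ⟨r³⟩ ∪ s r² ⟨r³⟩` (kernel `decide`). [folklore] -/
theorem dihedral18_realizes_2_2_6 :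
    TripleProductProperty ({DihedralGroup.r 0, DihedralGroup.sr 0} : Finset (DihedralGroup 9))
      ({DihedralGroup.r 0, DihedralGroup.sr 1} : Finset (DihedralGroup 9))
      ({DihedralGroup.r 0, DihedralGroup.r 3, DihedralGroup.r 6, DihedralGroup.sr 2, DihedralGroup.sr 5, DihedralGroup.sr 8} : Finset (DihedralGroup 9)) := by
  unfold TripleProductProperty; decide +kernel

/-- `D_{24} = DihedralGroup 12` realizes `⟨2, 2, 8⟩` (volume `32` = (4/3)·|G|): `S = {1, s}`, `T = {1, sr}`,
`U = ⟨r³⟩ ∪ s r² ⟨r³⟩` (kernel `decide`). [folklore] -/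
theorem dihedral24_realizes_2_2_8 :
    TripleProductProperty ({DihedralGroup.r 0, DihedralGroup.sr 0} : Finset (DihedralGroup 12))
      ({DihedralGroup.r 0, DihedralGroup.sr 1} : Finset (DihedralGroup 12))
      ({DihedralGroup.r 0, DihedralGroup.r 3, DihedralGroup.r 6, DihedralGroup.r 9, DihedralGroup.sr 2, DihedralGroup.sr 5, DihedralGroup.sr 8, DihedralGroup.sr 11} : Finset (DihedralGroup 12)) := by
  unfold TripleProductProperty; decide +kernel

/-- `D_{30} = DihedralGroup 15` realizes `⟨2, 2, 10⟩` (volume `40` = (4/3)·|G|): `S = {1, s}`, `T = {1, sr}`,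
`U = ⟨r³⟩ ∪ s r² ⟨r³⟩` (kernel `decide`). [folklore] -/
theorem dihedral30_realizes_2_2_10 :
    TripleProductProperty ({DihedralGroup.r 0, DihedralGroup.sr 0} : Finset (DihedralGroup 15))
      ({DihedralGroup.r 0, DihedralGroup.sr 1} : Finset (DihedralGroup 15))
      ({DihedralGroup.r 0, DihedralGroup.r 3, DihedralGroup.r 6, DihedralGroup.r 9, DihedralGroup.r 12, DihedralGroup.sr 2, DihedralGroup.sr 5, DihedralGroup.sr 8, DihedralGroup.sr 11, DihedralGroup.sr 14} : Finset (DihedralGroup 15)) := by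
  unfold TripleProductProperty; decide +kernel

/-- `D_{36} = DihedralGroup 18` realizes `⟨2, 2, 12⟩` (volume `48` = (4/3)·|G|): `S = {1, s}`, `T = {1, sr}`,
`U = ⟨r³⟩ ∪ s r² ⟨r³⟩` (kernel `decide`). [folklore] -/
theorem dihedral36_realizes_2_2_12 :
    TripleProductProperty ({DihedralGroup.r 0, DihedralGroup.sr 0} : Finset (DihedralGroup 18))
      ({DihedralGroup.r 0, DihedralGroup.sr 1} : Finset (DihedralGroup 18))
      ({DihedralGroup.r 0, DihedralGroup.r 3, DihedralGroup.r 6, DihedralGroup.r 9, DihedralGroup.r 12, DihedralGroup.r 15, DihedralGroup.sr 2, DihedralGroup.sr 5, DihedralGroup.sr 8, DihedralGroup.sr 11, DihedralGroup.sr 14, DihedralGroup.sr 17} : Finset (DihedralGroup 18)) := by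
  unfold TripleProductProperty; decide +kernel

/-- `D_{42} = DihedralGroup 21` realizes `⟨2, 2, 14⟩` (volume `56` = (4/3)·|G|): `S = {1, s}`, `T = {1, sr}`,
`U = ⟨r³⟩ ∪ s r² ⟨r³⟩` (kernel `decide`). [folklore] -/
theorem dihedral42_realizes_2_2_14 :
    TripleProductProperty ({DihedralGroup.r 0, DihedralGroup.sr 0} : Finset (DihedralGroup 21))
      ({DihedralGroup.r 0, DihedralGroup.sr 1} : Finset (DihedralGroup 21))
      ({DihedralGroup.r 0, DihedralGroup.r 3, DihedralGroup.r 6, DihedralGroup.r 9, DihedralGroup.r 12, DihedralGroup.r 15, DihedralGroup.r 18, DihedralGroup.sr 2, DihedralGroup.sr 5, DihedralGroup.sr 8, DihedralGroup.sr 11, DihedralGroup.sr 14, DihedralGroup.sr 17, DihedralGroup.sr 20} : Finset (DihedralGroup 21)) := by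
  unfold TripleProductProperty; decide +kernel

/-- `D_{48} = DihedralGroup 24` realizes `⟨2, 2, 16⟩` (volume `64` = (4/3)·|G|): `S = {1, s}`, `T = {1, sr}`,
`U = ⟨r³⟩ ∪ s r² ⟨r³⟩` (kernel `decide`). [folklore] -/
theorem dihedral48_realizes_2_2_16 :
    TripleProductProperty ({DihedralGroup.r 0, DihedralGroup.sr 0} : Finset (DihedralGroup 24))
      ({DihedralGroup.r 0, DihedralGroup.sr 1} : Finset (DihedralGroup 24))
      ({DihedralGroup.r 0, DihedralGroup.r 3, DihedralGroup.r 6, DihedralGroup.r 9, DihedralGroup.r 12, DihedralGroup.r 15, DihedralGroup.r 18, DihedralGroup.r 21, DihedralGroup.sr 2, DihedralGroup.sr 5, DihedralGroup.sr 8, DihedralGroup.sr 11, DihedralGroup.sr 14, DihedralGroup.sr 17, DihedralGroup.sr 20, DihedralGroup.sr 23} : Finset (DihedralGroup 24)) := by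
  unfold TripleProductProperty; decide +kernel

end Summit.MatrixMultiplication.OmegaCensus
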